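import Summits.NavierStokesRegularity.FluidComputer.RiccatiSummation
import Summits.NavierStokesRegularity.FluidComputer.LevelTransferFloor
import Summits.NavierStokesRegularity.FluidComputer.BlockEnergyIdentity
import Summits.NavierStokesRegularity.FluidComputer.BlockAmplitudeCeiling
import HarnessLib

/-!
# Fluid computer — support: the `8^j`-weighted block balance of ONE SLICE (Cheskidov–Zaya's Riccati integrand)

HONEST FRAMING (cell `pub-fluidc`, verbatim): *low prior, high value-of-information experiment on Tao's
machine paradigm; NOT a claim that NS blows up.* Support file of the OPTIMAL `Ḃ^{3/2}_{2,2}` row (successors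
`RiccatiInequality` / `Besov32Clock`). Everything here concerns ONE smooth, divergence-free, finite-energy field `w` on
`ℝ³` (a slice `u(τ)`), `a_l = ‖Δ̇_l w‖₂`, `s_l = ‖Δ̇_l w‖_∞`, `N_j(w) = ∫ ⟪Δ̇_j w, Δ̇_j((w·∇)w)⟫`, `S_j(w) = ∑_i ‖∂_i Δ̇_j w‖₂²`:

* `exists_enorm_transfer_le_local` — the POINTWISE transfer ceiling `‖N_j(w)‖ ≤ A·(a_j ∑_{|m|≤2} a_{j+m} T_{j+m} + s_j Q_j)`
  (Cheskidov–Dai (3.6) block by block; the slice form behind L12″ `LevelTransferFloor.blockL2_sq_le_add_local`);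
* `tsum_weighted_sq_le_window_add` — for every weight `1 ≤ κ ≤ 5`: `∑_l 2^{κl} a_l² ≤ ∑_{|l|≤L} 2^{κl} a_l² + 2^{−L}·R`,
  `R = (C_r³C₂S₃)² + (C₂E₀)²`, whenever `T₃(w) ≤ S₃` (third derivatives, `LPBounds.thirdSum`) and `‖w‖₂ ≤ E₀` —
  UNIFORM tails (rows `κ = 3` = `Ḃ^{3/2}_{2,2}` and `κ = 5` = the dissipation row at weight `8^j`);
* `weighted_slice_le` (**THE RICCATI INTEGRAND**, Cheskidov–Zaya 2016 Thm. 2.2 for one slice) — an absolute `K₁ > 0`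
  with `∑_{|j|≤L} 8^j (−ν S_j(w) − N_j(w)) ≤ ν/(3C_r²+1) · 2^{−L} R + (K₁/ν) · (∑_j 8^j a_j²)²`: reverse Bernstein, the
  pointwise ceiling, THE SUMMATION `riccati_summation` (`≤ 2^{18} A C_B · y · D^{1/2}`), Young, and the tails of `D`.

0 sorry; no definitions; no named facts.

## References

* A. Cheskidov, K. Zaya, J. Math. Phys. 57 (2016) 023101 = arXiv:1503.01784, Thm. 2.2 (p. 5). [CheskidovZaya2016]
* A. Cheskidov, M. Dai, arXiv:1507.06611 = Proc. Edinburgh Math. Soc. (2025), §3.1 (3.6). [CheskidovDai2015]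
* H. Bahouri, J.-Y. Chemin, R. Danchin, *Fourier Analysis and Nonlinear PDE*, Springer 2011, Lemma 2.1.
  [BahouriCheminDanchin2011]
-/

noncomputable section

open MeasureTheory Set Function Filter Topology
open scoped ENNReal NNReal RealInnerProductSpace
open Literature.Analysis.FluidPDE Literature.Analysis.FunctionSpaces
open Literature.Analysis.FluidPDE.LPBounds (thirdSum)
open Summit.NavierStokesRegularity.FluidComputer.RiccatiSummation
open Summit.NavierStokesRegularity.FluidComputer.BlockEnergyIdentity
open Summit.NavierStokesRegularity.FluidComputer.BlockAmplitudeCeiling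

namespace Summit.NavierStokesRegularity.FluidComputer.RiccatiSlice

/-! ## The pointwise transfer ceiling (slice form of L12″) -/

/-- **The pointwise transfer ceiling.** There is an absolute FINITE constant `A` such that for every smooth,
divergence-free `L²` field `w` on `ℝ³` and every level `j`:
`‖∫ ⟪Δ̇_j w, Δ̇_j((w·∇)w)⟫‖ ≤ A · ( a_j ∑_{|m|≤2} a_{j+m} T_{j+m} + s_j Q_j )`, `a_l = ‖Δ̇_l w‖₂`, `s_l = ‖Δ̇_l w‖_∞`,
`T_l = ∑_{l'≤l−3} 2^{l'} s_{l'}`, `Q_j = paraQ2 a (2^· a) j` (Cheskidov–Dai's low-mode form (3.6) of the block balance,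
with the Littlewood–Paley constants of `exists_eLpNorm_top_fderiv_blockFn_le` / `exists_lipschitz_blockFn_le` /
`lpBounds (Fin 3)` collected into one number). [cite: CheskidovDai2015, §3.1 (3.6)] -/
theorem exists_enorm_transfer_le_local :
    ∃ A : ℝ≥0∞, A ≠ ∞ ∧ ∀ (w : EuclideanSpace ℝ (Fin 3) → EuclideanSpace ℝ (Fin 3)),
      IsSmoothL2Field w → VectorCalculus.IsDivFree w → ∀ j : ℤ,
        ‖∫ x, ⟪blockFn j w x, blockFn j (convect w w) x⟫‖ₑ ≤
          A * (blockL2 w j * ∑ m ∈ Finset.Icc (-2 : ℤ) 2, blockL2 w (j + m) *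
                paraT (fun l => (2 : ℝ≥0∞) ^ l * blockSup w l) (j + m) +
              blockSup w j * paraQ2 (blockL2 w) (fun l => (2 : ℝ≥0∞) ^ l * blockL2 w l) j) := by
  set K := lpBounds (Fin 3) with hK
  obtain ⟨Csup, hCsup⟩ := exists_eLpNorm_top_fderiv_blockFn_le (E := EuclideanSpace ℝ (Fin 3)) (ι := Fin 3)
  obtain ⟨CL, hCL⟩ := exists_lipschitz_blockFn_le (E := EuclideanSpace ℝ (Fin 3)) (ι := Fin 3)
  set d : ℝ≥0∞ := (Fintype.card (Fin (Module.finrank ℝ (EuclideanSpace ℝ (Fin 3)))) : ℝ≥0∞) with hd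
  set M₁ : ℝ≥0∞ := ENNReal.ofReal
    (∫ z : EuclideanSpace ℝ (Fin 3), ‖blockKernel (EuclideanSpace ℝ (Fin 3)) 0 z‖ * ‖z‖) with hM₁
  set C₁ : ℝ≥0∞ := ∫⁻ z, ‖blockKernel (EuclideanSpace ℝ (Fin 3)) 0 z‖ₑ with hC₁
  have hC₁top : C₁ ≠ ∞ := (integrable_blockKernel (E := EuclideanSpace ℝ (Fin 3)) 0).2.ne
  have hdtop : d ≠ ∞ := ENNReal.natCast_ne_top _
  set A₁₂ : ℝ≥0∞ := d * (4 * d * CL * M₁ * K.Cb + 64 * K.C₂ * K.Cb) + d * K.C₂ * Csup with hA₁₂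
  set A₃ : ℝ≥0∞ := d * C₁ * K.Cb with hA₃
  have hA₁₂top : A₁₂ ≠ ∞ := by
    refine ENNReal.add_ne_top.2 ⟨ENNReal.mul_ne_top hdtop (ENNReal.add_ne_top.2 ⟨?_, ?_⟩), ?_⟩
    · exact ENNReal.mul_ne_top (ENNReal.mul_ne_top (ENNReal.mul_ne_top (ENNReal.mul_ne_top (by norm_num) hdtop)
        ENNReal.coe_ne_top) ENNReal.ofReal_ne_top) ENNReal.coe_ne_top
    · exact ENNReal.mul_ne_top (ENNReal.mul_ne_top (by norm_num) ENNReal.coe_ne_top) ENNReal.coe_ne_top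
    · exact ENNReal.mul_ne_top (ENNReal.mul_ne_top hdtop ENNReal.coe_ne_top) ENNReal.coe_ne_top
  have hA₃top : A₃ ≠ ∞ := ENNReal.mul_ne_top (ENNReal.mul_ne_top hdtop hC₁top) ENNReal.coe_ne_top
  refine ⟨A₁₂ + A₃, ENNReal.add_ne_top.2 ⟨hA₁₂top, hA₃top⟩, fun w hw hdiv j => ?_⟩
  have h36 := enorm_integral_inner_blockFn_convect_le_lowMode K hCsup hCL hw hdiv j
  have key : ∀ X Y : ℝ≥0∞, A₁₂ * X + A₃ * Y ≤ (A₁₂ + A₃) * (X + Y) := fun X Y => by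
    rw [mul_add]
    exact add_le_add (mul_le_mul_left le_self_add _) (mul_le_mul_left le_add_self _)
  exact h36.trans (key _ _)

/-! ## Per-block decay from the third derivatives; uniform tails of the weighted rows -/

/-- **`2^{3l} ‖Δ̇_l w‖₂ ≤ C_r³ C₂ · T₃(w)`** for a smooth `L²` field: reverse Bernstein (`2^l a_l ≤ C_r g_l`) and the
decay of the weighted block gradients through the third derivatives (`2^l g_l ≤ C_r² C₂ 2^{−l} T₃`).
[cite: BahouriCheminDanchin2011, Lemma 2.1] -/
theorem two_pow_three_mul_blockL2_le {w : EuclideanSpace ℝ (Fin 3) → EuclideanSpace ℝ (Fin 3)}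
    (hw : IsSmoothL2Field w) (l : ℤ) :
    ((2 : ℝ≥0∞) ^ l) ^ 3 * blockL2 w l ≤
      ((lpBounds (Fin 3)).Cr : ℝ≥0∞) ^ 3 * (lpBounds (Fin 3)).C₂ * thirdSum w := by
  set K := lpBounds (Fin 3) with hK
  have h2l0 : (2 : ℝ≥0∞) ^ l ≠ 0 := (ENNReal.zpow_pos two_ne_zero ENNReal.ofNat_ne_top l).ne'
  have h2ltop : (2 : ℝ≥0∞) ^ l ≠ ∞ := ENNReal.zpow_ne_top two_ne_zero ENNReal.ofNat_ne_top l
  have h1 := K.two_zpow_mul_blockL2_le hw l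
  have h3 := K.two_zpow_mul_blockGrad_le_third hw l
  calc ((2 : ℝ≥0∞) ^ l) ^ 3 * blockL2 w l = (2 : ℝ≥0∞) ^ l * (2 : ℝ≥0∞) ^ l * ((2 : ℝ≥0∞) ^ l * blockL2 w l) := by
        ring
    _ ≤ (2 : ℝ≥0∞) ^ l * (2 : ℝ≥0∞) ^ l * (K.Cr * blockGrad w l) := by gcongr
    _ = K.Cr * (2 : ℝ≥0∞) ^ l * ((2 : ℝ≥0∞) ^ l * blockGrad w l) := by ring
    _ ≤ K.Cr * (2 : ℝ≥0∞) ^ l * ((K.Cr : ℝ≥0∞) ^ 2 * K.C₂ * (2 ^ l)⁻¹ * thirdSum w) := by gcongr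
    _ = (K.Cr : ℝ≥0∞) ^ 3 * K.C₂ * thirdSum w * ((2 : ℝ≥0∞) ^ l * (2 ^ l)⁻¹) := by ring
    _ = (K.Cr : ℝ≥0∞) ^ 3 * K.C₂ * thirdSum w := by rw [ENNReal.mul_inv_cancel h2l0 h2ltop, mul_one]

/-- The third-derivative sum `T₃(w)` of a smooth `L²` field is finite. [folklore] -/
theorem thirdSum_ne_top {w : EuclideanSpace ℝ (Fin 3) → EuclideanSpace ℝ (Fin 3)} (hw : IsSmoothL2Field w) :
    thirdSum w ≠ ∞ := by
  unfold thirdSum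
  refine ENNReal.sum_ne_top.2 fun i _ => ENNReal.sum_ne_top.2 fun k _ => ENNReal.sum_ne_top.2 fun m _ => ?_
  exact (((hw.fderiv_apply _).fderiv_apply _).memLp_fderiv_apply _).eLpNorm_ne_top

/-- The weight `2^{κ l}` against the integer power: `2^{κ l} = (2^l)^κ` in `ℝ≥0∞`. [folklore] -/
theorem two_rpow_mul_intCast (κ : ℝ) (l : ℤ) :
    (2 : ℝ≥0∞) ^ (κ * (l : ℝ)) = ((2 : ℝ≥0∞) ^ l) ^ κ := by
  rw [← ENNReal.rpow_intCast, ← ENNReal.rpow_mul, mul_comm]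

/-- **High blocks**: for `1 ≤ l` (indeed `0 ≤ l`) and `κ ≤ 5`, `2^{κl} a_l² ≤ 2^{−l} (C_r³ C₂ T₃(w))²`
(`2^{κl} a_l² = 2^{(κ−6)l} (2^{3l} a_l)²`). [folklore] -/
theorem weighted_sq_le_of_nonneg {w : EuclideanSpace ℝ (Fin 3) → EuclideanSpace ℝ (Fin 3)}
    (hw : IsSmoothL2Field w) {κ : ℝ} (hκ : κ ≤ 5) {l : ℤ} (hl : 0 ≤ l) :
    (2 : ℝ≥0∞) ^ (κ * (l : ℝ)) * blockL2 w l ^ 2 ≤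
      ((2 : ℝ≥0∞) ^ l)⁻¹ * (((lpBounds (Fin 3)).Cr : ℝ≥0∞) ^ 3 * (lpBounds (Fin 3)).C₂ * thirdSum w) ^ 2 := by
  set K := lpBounds (Fin 3) with hK
  have h2 : (2 : ℝ≥0∞) ≠ 0 := two_ne_zero
  have h2' : (2 : ℝ≥0∞) ≠ ∞ := ENNReal.ofNat_ne_top
  have hb := two_pow_three_mul_blockL2_le hw l
  -- `2^{κ l} ≤ 2^{5 l} = 2^{-l} (2^{l})^6`
  have hκl : (2 : ℝ≥0∞) ^ (κ * (l : ℝ)) ≤ (2 : ℝ≥0∞) ^ ((5 : ℝ) * (l : ℝ)) :=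
    ENNReal.rpow_le_rpow_of_exponent_le (by norm_num)
      (mul_le_mul_of_nonneg_right hκ (by exact_mod_cast hl))
  have h2l0 : (2 : ℝ≥0∞) ^ l ≠ 0 := (ENNReal.zpow_pos h2 h2' l).ne'
  have h2ltop : (2 : ℝ≥0∞) ^ l ≠ ∞ := ENNReal.zpow_ne_top h2 h2' l
  have h5 : (2 : ℝ≥0∞) ^ ((5 : ℝ) * (l : ℝ)) = ((2 : ℝ≥0∞) ^ l)⁻¹ * (((2 : ℝ≥0∞) ^ l) ^ 3) ^ 2 := by
    rw [two_rpow_mul_intCast, show (5 : ℝ) = ((5 : ℕ) : ℝ) by norm_num, ENNReal.rpow_natCast]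
    calc ((2 : ℝ≥0∞) ^ l) ^ 5 = (((2 : ℝ≥0∞) ^ l)⁻¹ * (2 : ℝ≥0∞) ^ l) * ((2 : ℝ≥0∞) ^ l) ^ 5 := by
          rw [ENNReal.inv_mul_cancel h2l0 h2ltop, one_mul]
      _ = ((2 : ℝ≥0∞) ^ l)⁻¹ * (((2 : ℝ≥0∞) ^ l) ^ 3) ^ 2 := by ring
  calc (2 : ℝ≥0∞) ^ (κ * (l : ℝ)) * blockL2 w l ^ 2 ≤ (2 : ℝ≥0∞) ^ ((5 : ℝ) * (l : ℝ)) * blockL2 w l ^ 2 := by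
        gcongr
    _ = ((2 : ℝ≥0∞) ^ l)⁻¹ * (((2 : ℝ≥0∞) ^ l) ^ 3 * blockL2 w l) ^ 2 := by rw [h5]; ring
    _ ≤ ((2 : ℝ≥0∞) ^ l)⁻¹ * ((K.Cr : ℝ≥0∞) ^ 3 * K.C₂ * thirdSum w) ^ 2 := by gcongr

/-- **Low blocks**: for `l ≤ 0` and `1 ≤ κ`, `2^{κl} a_l² ≤ 2^{l} (C₂ ‖w‖₂)²` (`a_l ≤ C₂‖w‖₂`, `2^{κl} ≤ 2^l`).
[folklore] -/
theorem weighted_sq_le_of_nonpos {w : EuclideanSpace ℝ (Fin 3) → EuclideanSpace ℝ (Fin 3)}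
    (hw : MemLp w 2 volume) {κ : ℝ} (hκ : 1 ≤ κ) {l : ℤ} (hl : l ≤ 0) :
    (2 : ℝ≥0∞) ^ (κ * (l : ℝ)) * blockL2 w l ^ 2 ≤
      (2 : ℝ≥0∞) ^ l * ((lpBounds (Fin 3)).C₂ * eLpNorm w 2 volume) ^ 2 := by
  set K := lpBounds (Fin 3) with hK
  have hb := K.blockL2_le hw l
  have hκl : (2 : ℝ≥0∞) ^ (κ * (l : ℝ)) ≤ (2 : ℝ≥0∞) ^ ((1 : ℝ) * (l : ℝ)) := by
    refine ENNReal.rpow_le_rpow_of_exponent_le (by norm_num) ?_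
    have hl' : (l : ℝ) ≤ 0 := by exact_mod_cast hl
    nlinarith
  rw [one_mul, ENNReal.rpow_intCast] at hκl
  calc (2 : ℝ≥0∞) ^ (κ * (l : ℝ)) * blockL2 w l ^ 2 ≤ (2 : ℝ≥0∞) ^ l * blockL2 w l ^ 2 := by gcongr
    _ ≤ (2 : ℝ≥0∞) ^ l * (K.C₂ * eLpNorm w 2 volume) ^ 2 := by gcongr

/-- `∑_{n ≥ 0} 2^{−(L+1+n)} = 2^{−L}` in `ℝ≥0∞` (as an inequality). [folklore] -/
theorem tsum_two_inv_pow_succ_le (L : ℕ) : ∑' n : ℕ, (2⁻¹ : ℝ≥0∞) ^ (L + 1 + n) ≤ (2⁻¹ : ℝ≥0∞) ^ L := by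
  have h : ∑' n : ℕ, (2⁻¹ : ℝ≥0∞) ^ (L + 1 + n) = (2⁻¹ : ℝ≥0∞) ^ (L + 1) * ∑' n : ℕ, (2⁻¹ : ℝ≥0∞) ^ n := by
    rw [← ENNReal.tsum_mul_left]
    exact tsum_congr fun n => by rw [pow_add]
  rw [h, ENNReal.tsum_geometric, ENNReal.one_sub_inv_two, inv_inv, pow_succ, mul_assoc,
    ENNReal.inv_mul_cancel two_ne_zero ENNReal.ofNat_ne_top, mul_one]

/-- **Uniform tails of the weighted rows.** For a smooth `L²` field `w` on `ℝ³` with `T₃(w) ≤ S₃` and `‖w‖₂ ≤ E₀`,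
every weight `1 ≤ κ ≤ 5` and every `L`:
`∑_l 2^{κl} ‖Δ̇_l w‖₂² ≤ ∑_{|l|≤L} 2^{κl} ‖Δ̇_l w‖₂² + 2^{−L} · ((C_r³ C₂ S₃)² + (C₂ E₀)²)`
— on a time window where the third derivatives and the energy are bounded, the `Ḃ^{κ/2}_{2,2}` rows are approximated by
their symmetric windows UNIFORMLY (`κ = 3`: the `Ḃ^{3/2}_{2,2}` row; `κ = 5`: the dissipation row at weight `8^j`).
[folklore] -/
theorem tsum_weighted_sq_le_window_add {w : EuclideanSpace ℝ (Fin 3) → EuclideanSpace ℝ (Fin 3)}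
    (hw : IsSmoothL2Field w) {S₃ E₀ : ℝ≥0∞} (hS₃ : thirdSum w ≤ S₃) (hE₀ : eLpNorm w 2 volume ≤ E₀)
    {κ : ℝ} (hκ1 : 1 ≤ κ) (hκ5 : κ ≤ 5) (L : ℕ) :
    ∑' l : ℤ, (2 : ℝ≥0∞) ^ (κ * (l : ℝ)) * blockL2 w l ^ 2 ≤
      (∑ l ∈ Finset.Icc (-(L : ℤ)) L, (2 : ℝ≥0∞) ^ (κ * (l : ℝ)) * blockL2 w l ^ 2) +
        (2⁻¹ : ℝ≥0∞) ^ L * ((((lpBounds (Fin 3)).Cr : ℝ≥0∞) ^ 3 * (lpBounds (Fin 3)).C₂ * S₃) ^ 2 +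
          ((lpBounds (Fin 3)).C₂ * E₀) ^ 2) := by
  set K := lpBounds (Fin 3) with hK
  have h2 : (2 : ℝ≥0∞) ≠ 0 := two_ne_zero
  have h2' : (2 : ℝ≥0∞) ≠ ∞ := ENNReal.ofNat_ne_top
  set R₁ : ℝ≥0∞ := ((K.Cr : ℝ≥0∞) ^ 3 * K.C₂ * S₃) ^ 2 with hR₁
  set R₂ : ℝ≥0∞ := (K.C₂ * E₀) ^ 2 with hR₂
  refine (LPBounds.tsum_le_sum_Icc_add_tails _ L).trans ?_
  gcongr
  -- the two tails
  have hinv : ∀ n : ℕ, ((2 : ℝ≥0∞) ^ ((L : ℤ) + 1 + n))⁻¹ = (2⁻¹ : ℝ≥0∞) ^ (L + 1 + n) := fun n => by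
    rw [show ((L : ℤ) + 1 + n) = ((L + 1 + n : ℕ) : ℤ) by push_cast; ring, zpow_natCast, ENNReal.inv_pow]
  have hlow : ∀ n : ℕ, (2 : ℝ≥0∞) ^ (-(L : ℤ) - 1 - n) = (2⁻¹ : ℝ≥0∞) ^ (L + 1 + n) := fun n => by
    rw [show (-(L : ℤ) - 1 - n) = -((L + 1 + n : ℕ) : ℤ) by push_cast; ring, ENNReal.zpow_neg, zpow_natCast,
      ENNReal.inv_pow]
  have hhi : ∑' n : ℕ, (2 : ℝ≥0∞) ^ (κ * (((L : ℤ) + 1 + n : ℤ) : ℝ)) * blockL2 w ((L : ℤ) + 1 + n) ^ 2 ≤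
      (2⁻¹ : ℝ≥0∞) ^ L * R₁ := by
    calc ∑' n : ℕ, (2 : ℝ≥0∞) ^ (κ * (((L : ℤ) + 1 + n : ℤ) : ℝ)) * blockL2 w ((L : ℤ) + 1 + n) ^ 2
        ≤ ∑' n : ℕ, (2⁻¹ : ℝ≥0∞) ^ (L + 1 + n) * (((K.Cr : ℝ≥0∞) ^ 3 * K.C₂ * thirdSum w) ^ 2) := by
          refine ENNReal.tsum_le_tsum fun n => ?_
          rw [← hinv n]
          exact weighted_sq_le_of_nonneg hw hκ5 (by positivity)
      _ = (∑' n : ℕ, (2⁻¹ : ℝ≥0∞) ^ (L + 1 + n)) * ((K.Cr : ℝ≥0∞) ^ 3 * K.C₂ * thirdSum w) ^ 2 :=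
          ENNReal.tsum_mul_right
      _ ≤ (2⁻¹ : ℝ≥0∞) ^ L * R₁ := by
          rw [hR₁]
          gcongr
          exact tsum_two_inv_pow_succ_le L
  have hlo : ∑' n : ℕ, (2 : ℝ≥0∞) ^ (κ * (((-(L : ℤ) - 1 - n : ℤ)) : ℝ)) * blockL2 w (-(L : ℤ) - 1 - n) ^ 2 ≤
      (2⁻¹ : ℝ≥0∞) ^ L * R₂ := by
    calc ∑' n : ℕ, (2 : ℝ≥0∞) ^ (κ * (((-(L : ℤ) - 1 - n : ℤ)) : ℝ)) * blockL2 w (-(L : ℤ) - 1 - n) ^ 2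
        ≤ ∑' n : ℕ, (2⁻¹ : ℝ≥0∞) ^ (L + 1 + n) * ((K.C₂ * eLpNorm w 2 volume) ^ 2) := by
          refine ENNReal.tsum_le_tsum fun n => ?_
          rw [← hlow n]
          exact weighted_sq_le_of_nonpos hw.memLp_two hκ1 (by omega)
      _ = (∑' n : ℕ, (2⁻¹ : ℝ≥0∞) ^ (L + 1 + n)) * (K.C₂ * eLpNorm w 2 volume) ^ 2 := ENNReal.tsum_mul_right
      _ ≤ (2⁻¹ : ℝ≥0∞) ^ L * R₂ := by
          rw [hR₂]
          gcongr
          exact tsum_two_inv_pow_succ_le L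
  calc (∑' n : ℕ, (2 : ℝ≥0∞) ^ (κ * (((L : ℤ) + 1 + n : ℤ) : ℝ)) * blockL2 w ((L : ℤ) + 1 + n) ^ 2) +
        ∑' n : ℕ, (2 : ℝ≥0∞) ^ (κ * (((-(L : ℤ) - 1 - n : ℤ)) : ℝ)) * blockL2 w (-(L : ℤ) - 1 - n) ^ 2
      ≤ (2⁻¹ : ℝ≥0∞) ^ L * R₁ + (2⁻¹ : ℝ≥0∞) ^ L * R₂ := add_le_add hhi hlo
    _ = (2⁻¹ : ℝ≥0∞) ^ L * (R₁ + R₂) := (mul_add _ _ _).symm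

/-- The weights `2^y`, `y ∈ ℝ`, are finite in `ℝ≥0∞`. [folklore] -/
theorem two_rpow_ne_top (y : ℝ) : (2 : ℝ≥0∞) ^ y ≠ ∞ := by
  rw [Ne, ENNReal.rpow_eq_top_iff]; push Not
  exact ⟨fun h => absurd h two_ne_zero, fun h => absurd h ENNReal.ofNat_ne_top⟩

/-- The weighted rows `1 ≤ κ ≤ 5` of a smooth `L²` field are finite. [folklore] -/
theorem tsum_weighted_sq_ne_top {w : EuclideanSpace ℝ (Fin 3) → EuclideanSpace ℝ (Fin 3)}
    (hw : IsSmoothL2Field w) {κ : ℝ} (hκ1 : 1 ≤ κ) (hκ5 : κ ≤ 5) :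
    ∑' l : ℤ, (2 : ℝ≥0∞) ^ (κ * (l : ℝ)) * blockL2 w l ^ 2 ≠ ∞ := by
  have h := tsum_weighted_sq_le_window_add hw le_rfl le_rfl hκ1 hκ5 0
  refine ne_top_of_le_ne_top ?_ h
  refine ENNReal.add_ne_top.2 ⟨?_, ?_⟩
  · exact ENNReal.sum_ne_top.2 fun l _ => ENNReal.mul_ne_top (two_rpow_ne_top _)
      (ENNReal.pow_ne_top ((hw.blockFn l).memLp_two).eLpNorm_ne_top)
  · exact ENNReal.mul_ne_top (ENNReal.pow_ne_top (by norm_num))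
      (ENNReal.add_ne_top.2 ⟨ENNReal.pow_ne_top (ENNReal.mul_ne_top (ENNReal.mul_ne_top
        (ENNReal.pow_ne_top ENNReal.coe_ne_top) ENNReal.coe_ne_top) (thirdSum_ne_top hw)),
        ENNReal.pow_ne_top (ENNReal.mul_ne_top ENNReal.coe_ne_top hw.memLp_two.eLpNorm_ne_top)⟩)

/-! ## The Riccati integrand: the `8^j`-weighted sum of the block balances of one slice -/

/-- `toReal` of the weight `2^{2j}` is `4^j`. [folklore] -/
theorem toReal_two_rpow_two_mul (j : ℤ) : ((2 : ℝ≥0∞) ^ ((2 : ℝ) * (j : ℝ))).toReal = (4 : ℝ) ^ j := by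
  rw [two_rpow_mul_intCast, show (2 : ℝ) = ((2 : ℕ) : ℝ) by norm_num, ENNReal.rpow_natCast, ENNReal.toReal_pow,
    toReal_two_zpow, ← zpow_natCast, ← zpow_mul, mul_comm, zpow_mul]
  norm_num

/-- **THE RICCATI INTEGRAND (Cheskidov–Zaya 2016, Thm. 2.2, one time slice).** There is an absolute `K₁ > 0` such
that for every `ν > 0`, every smooth divergence-free `L²` field `w` on `ℝ³` with `T₃(w) ≤ S₃`, `‖w‖₂ ≤ E₀`, and every `L`:
`∑_{|j|≤L} 8^j (−ν S_j(w) − N_j(w)) ≤ ν/(3C_r²+1) · 2^{−L}((C_r³C₂S₃)² + (C₂E₀)²) + (K₁/ν) · (∑_j 8^j ‖Δ̇_j w‖₂²)²`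
(`C_r, C₂` of `lpBounds (Fin 3)`). Reverse Bernstein `4^j a_j² ≤ 3C_r² S_j` makes the viscous part `≤ −ν/(3C_r²+1)·D_L`;
the pointwise ceiling and `riccati_summation` (Bernstein `s_l ≤ C_B 2^{3l/2} a_l`, `exists_blockSup_le_blockL2`) bound the
nonlinear part by `2^{18} A C_B · y · D^{1/2}`; Young gives `ν/(3C_r²+1)·D + (K₁/ν) y²`; `D − D_L ≤ 2^{−L}(…)` by the uniform
tails. The truncation error vanishes as `L → ∞` UNIFORMLY on windows with `S₃, E₀` fixed, so the successor can
integrate in time and pass to the limit without differentiating an infinite sum.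
[cite: CheskidovZaya2016, Thm. 2.2 (p. 5)] [cite: CheskidovDai2015, §3.1 (3.6)] -/
theorem weighted_slice_le :
    ∃ K₁ : ℝ, 0 < K₁ ∧ ∀ (ν : ℝ), 0 < ν →
      ∀ (w : EuclideanSpace ℝ (Fin 3) → EuclideanSpace ℝ (Fin 3)), IsSmoothL2Field w → VectorCalculus.IsDivFree w →
      ∀ (S₃ E₀ : ℝ≥0), thirdSum w ≤ S₃ → eLpNorm w 2 volume ≤ E₀ → ∀ L : ℕ,
        ∑ j ∈ Finset.Icc (-(L : ℤ)) L, ((2 : ℝ≥0∞) ^ ((3 : ℝ) * (j : ℝ))).toReal *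
            (-ν * (∑ i, ∫ x, ‖fderiv ℝ (blockFn j w) x (stdOrthonormalBasis ℝ (EuclideanSpace ℝ (Fin 3)) i)‖ ^ 2) -
              ∫ x, ⟪blockFn j w x, blockFn j (convect w w) x⟫) ≤
          ν / (3 * ((lpBounds (Fin 3)).Cr : ℝ) ^ 2 + 1) *
              ((2⁻¹ : ℝ≥0∞) ^ L * ((((lpBounds (Fin 3)).Cr : ℝ≥0∞) ^ 3 * (lpBounds (Fin 3)).C₂ * S₃) ^ 2 +
                ((lpBounds (Fin 3)).C₂ * E₀) ^ 2)).toReal +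
            K₁ / ν * ((∑' j : ℤ, (2 : ℝ≥0∞) ^ ((3 : ℝ) * (j : ℝ)) * blockL2 w j ^ 2).toReal) ^ 2 := by
  set K := lpBounds (Fin 3) with hK
  obtain ⟨A, hAtop, hA⟩ := exists_enorm_transfer_le_local
  obtain ⟨CB, -, hB⟩ := exists_blockSup_le_blockL2
  set A' : ℝ := (2 ^ 18 * A * CB).toReal with hA'
  refine ⟨(3 * (K.Cr : ℝ) ^ 2 + 1) * A' ^ 2 / 4 + 1, by positivity, fun ν hν w hw hdiv S₃ E₀ hS₃ hE₀ L => ?_⟩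
  have h2 : (2 : ℝ≥0∞) ≠ 0 := two_ne_zero
  have h2' : (2 : ℝ≥0∞) ≠ ∞ := ENNReal.ofNat_ne_top
  -- abbreviations
  set e := stdOrthonormalBasis ℝ (EuclideanSpace ℝ (Fin 3)) with he
  set I : Finset ℤ := Finset.Icc (-(L : ℤ)) L with hI
  set a : ℤ → ℝ≥0∞ := blockL2 w with ha
  set σ : ℤ → ℝ≥0∞ := blockSup w with hσ
  set S : ℤ → ℝ := fun j => ∑ i, ∫ x, ‖fderiv ℝ (blockFn j w) x (e i)‖ ^ 2 with hS
  set N : ℤ → ℝ := fun j => ∫ x, ⟪blockFn j w x, blockFn j (convect w w) x⟫ with hN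
  set W : ℤ → ℝ≥0∞ := fun j => (2 : ℝ≥0∞) ^ ((3 : ℝ) * (j : ℝ)) with hW
  set M : ℤ → ℝ≥0∞ := fun j => a j * ∑ m ∈ Finset.Icc (-2 : ℤ) 2, a (j + m) *
      paraT (fun l' => (2 : ℝ≥0∞) ^ l' * σ l') (j + m) + σ j * paraQ2 a (fun l => (2 : ℝ≥0∞) ^ l * a l) j with hM
  set y : ℝ≥0∞ := ∑' j : ℤ, W j * a j ^ 2 with hy
  set D : ℝ≥0∞ := ∑' j : ℤ, (2 : ℝ≥0∞) ^ ((5 : ℝ) * (j : ℝ)) * a j ^ 2 with hD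
  set DL : ℝ≥0∞ := ∑ j ∈ I, (2 : ℝ≥0∞) ^ ((5 : ℝ) * (j : ℝ)) * a j ^ 2 with hDL
  set R : ℝ≥0∞ := (2⁻¹ : ℝ≥0∞) ^ L * (((K.Cr : ℝ≥0∞) ^ 3 * K.C₂ * S₃) ^ 2 + (K.C₂ * E₀) ^ 2) with hR
  set ε : ℝ := ν / (3 * (K.Cr : ℝ) ^ 2 + 1) with hε
  have hε0 : 0 < ε := div_pos hν (by positivity)
  -- finiteness
  have hytop : y ≠ ∞ := tsum_weighted_sq_ne_top hw (by norm_num) (by norm_num)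
  have hDtop : D ≠ ∞ := tsum_weighted_sq_ne_top hw (by norm_num) (by norm_num)
  have hRtop : R ≠ ∞ := ENNReal.mul_ne_top (ENNReal.pow_ne_top (ENNReal.inv_ne_top.2 h2))
    (ENNReal.add_ne_top.2 ⟨ENNReal.pow_ne_top (ENNReal.mul_ne_top (ENNReal.mul_ne_top
      (ENNReal.pow_ne_top ENNReal.coe_ne_top) ENNReal.coe_ne_top) ENNReal.coe_ne_top),
      ENNReal.pow_ne_top (ENNReal.mul_ne_top ENNReal.coe_ne_top ENNReal.coe_ne_top)⟩)
  have haj : ∀ j, a j ^ 2 ≠ ∞ := fun j => ENNReal.pow_ne_top ((hw.blockFn j).memLp_two).eLpNorm_ne_top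
  have hWtop : ∀ j, W j ≠ ∞ := fun j => two_rpow_ne_top _
  have hDLtop : DL ≠ ∞ := ENNReal.sum_ne_top.2 fun j _ => ENNReal.mul_ne_top (two_rpow_ne_top _) (haj j)
  have hDle : D ≤ DL + R := tsum_weighted_sq_le_window_add hw (by exact_mod_cast hS₃) (by exact_mod_cast hE₀)
    (by norm_num) (by norm_num) L
  have hS0 : ∀ j, 0 ≤ S j := fun j => Finset.sum_nonneg fun i _ => integral_nonneg fun x => by positivity
  -- (i) the viscous part: `ε · D_L ≤ ν ∑ W_j S_j`
  have hdiss : ∀ j : ℤ, ((2 : ℝ≥0∞) ^ ((5 : ℝ) * (j : ℝ)) * a j ^ 2).toReal ≤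
      (3 * (K.Cr : ℝ) ^ 2 + 1) * ((W j).toReal * S j) := by
    intro j
    have h4 := four_pow_mul_toReal_blockL2_sq_le hw j
    have hsplit : (2 : ℝ≥0∞) ^ ((5 : ℝ) * (j : ℝ)) = W j * (2 : ℝ≥0∞) ^ ((2 : ℝ) * (j : ℝ)) := by
      rw [hW, ← ENNReal.rpow_add _ _ h2 h2']
      congr 1; ring
    rw [hsplit, ENNReal.toReal_mul, ENNReal.toReal_mul, toReal_two_rpow_two_mul]
    have hW0 : 0 ≤ (W j).toReal := ENNReal.toReal_nonneg
    calc (W j).toReal * (4 : ℝ) ^ j * (a j ^ 2).toReal = (W j).toReal * ((4 : ℝ) ^ j * (blockL2 w j ^ 2).toReal) := by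
          rw [ha]; ring
      _ ≤ (W j).toReal * (3 * (K.Cr : ℝ) ^ 2 * S j) := mul_le_mul_of_nonneg_left h4 hW0
      _ ≤ (W j).toReal * ((3 * (K.Cr : ℝ) ^ 2 + 1) * S j) := by
          refine mul_le_mul_of_nonneg_left ?_ hW0
          nlinarith [hS0 j]
      _ = (3 * (K.Cr : ℝ) ^ 2 + 1) * ((W j).toReal * S j) := by ring
  have hvisc : ε * DL.toReal ≤ ν * ∑ j ∈ I, (W j).toReal * S j := by
    have h1 : DL.toReal ≤ (3 * (K.Cr : ℝ) ^ 2 + 1) * ∑ j ∈ I, (W j).toReal * S j := by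
      rw [hDL, ENNReal.toReal_sum fun j _ => ENNReal.mul_ne_top (two_rpow_ne_top _) (haj j), Finset.mul_sum]
      exact Finset.sum_le_sum fun j _ => hdiss j
    have hc : 0 < 3 * (K.Cr : ℝ) ^ 2 + 1 := by positivity
    calc ε * DL.toReal ≤ ε * ((3 * (K.Cr : ℝ) ^ 2 + 1) * ∑ j ∈ I, (W j).toReal * S j) :=
          mul_le_mul_of_nonneg_left h1 hε0.le
      _ = ν * ∑ j ∈ I, (W j).toReal * S j := by
          rw [hε]; field_simp
  -- (ii) the nonlinear part: `∑ W_j (−N_j) ≤ (2^18 A C_B · y · D^{1/2}).toReal`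
  have hB' : ∀ l : ℤ, σ l ≤ CB * (2 : ℝ≥0∞) ^ ((3 / 2 : ℝ) * (l : ℝ)) * a l := fun l => by
    rw [show (3 / 2 : ℝ) * (l : ℝ) = 3 * (l : ℝ) / 2 by ring]
    exact hB w hw.memLp_two l
  have hric := riccati_summation a σ CB hB'
  set Φ : ℝ≥0∞ := 2 ^ 18 * A * CB * y * D ^ (1 / 2 : ℝ) with hΦ
  have hΦtop : Φ ≠ ∞ := ENNReal.mul_ne_top (ENNReal.mul_ne_top (ENNReal.mul_ne_top
    (ENNReal.mul_ne_top (by norm_num) hAtop) ENNReal.coe_ne_top) hytop)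
    (ENNReal.rpow_ne_top_of_nonneg (by norm_num) hDtop)
  have hnl_enn : ∑ j ∈ I, W j * ‖N j‖ₑ ≤ Φ := by
    calc ∑ j ∈ I, W j * ‖N j‖ₑ ≤ ∑ j ∈ I, W j * (A * M j) := Finset.sum_le_sum fun j _ => by
          gcongr; exact hA w hw hdiv j
      _ = A * ∑ j ∈ I, W j * M j := by rw [Finset.mul_sum]; exact Finset.sum_congr rfl fun j _ => by ring
      _ ≤ A * ∑' j : ℤ, W j * M j := by gcongr; exact ENNReal.sum_le_tsum I
      _ ≤ A * (2 ^ 18 * CB * y * D ^ (1 / 2 : ℝ)) := by gcongr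
      _ = Φ := by rw [hΦ]; ring
  have hnl : ∑ j ∈ I, (W j).toReal * (-N j) ≤ A' * y.toReal * D.toReal ^ (1 / 2 : ℝ) := by
    have hΦr : Φ.toReal = A' * y.toReal * D.toReal ^ (1 / 2 : ℝ) := by
      rw [hΦ, hA', ENNReal.toReal_mul, ENNReal.toReal_mul, ENNReal.toReal_rpow]
    calc ∑ j ∈ I, (W j).toReal * (-N j) ≤ ∑ j ∈ I, (W j * ‖N j‖ₑ).toReal := by
          refine Finset.sum_le_sum fun j _ => ?_
          rw [ENNReal.toReal_mul, Real.enorm_eq_ofReal_abs, ENNReal.toReal_ofReal (abs_nonneg _)]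
          exact mul_le_mul_of_nonneg_left (neg_le_abs _) ENNReal.toReal_nonneg
      _ = (∑ j ∈ I, W j * ‖N j‖ₑ).toReal :=
          (ENNReal.toReal_sum fun j _ => ENNReal.mul_ne_top (hWtop j) enorm_ne_top).symm
      _ ≤ Φ.toReal := ENNReal.toReal_mono hΦtop hnl_enn
      _ = A' * y.toReal * D.toReal ^ (1 / 2 : ℝ) := hΦr
  -- (iii) Young and the tails
  have hD0 : 0 ≤ D.toReal := ENNReal.toReal_nonneg
  have hy0 : 0 ≤ y.toReal := ENNReal.toReal_nonneg
  have hA'0 : 0 ≤ A' := ENNReal.toReal_nonneg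
  have hyoung : A' * y.toReal * D.toReal ^ (1 / 2 : ℝ) ≤ ε * D.toReal + A' ^ 2 / (4 * ε) * y.toReal ^ 2 := by
    set b : ℝ := D.toReal ^ (1 / 2 : ℝ) with hb
    have hb2 : b ^ 2 = D.toReal := by rw [hb, ← Real.sqrt_eq_rpow, Real.sq_sqrt hD0]
    rw [← hb2]
    have hkey : ε * b ^ 2 + A' ^ 2 / (4 * ε) * y.toReal ^ 2 - A' * y.toReal * b =
        (2 * ε * b - A' * y.toReal) ^ 2 / (4 * ε) := by
      field_simp
      ring
    nlinarith [hkey, div_nonneg (sq_nonneg (2 * ε * b - A' * y.toReal)) (by positivity : (0 : ℝ) ≤ 4 * ε)]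
  have htail : D.toReal ≤ DL.toReal + R.toReal := by
    rw [← ENNReal.toReal_add hDLtop hRtop]
    exact ENNReal.toReal_mono (ENNReal.add_ne_top.2 ⟨hDLtop, hRtop⟩) hDle
  -- assemble
  have hsplit : ∑ j ∈ I, (W j).toReal * (-ν * S j - N j) =
      -(ν * ∑ j ∈ I, (W j).toReal * S j) + ∑ j ∈ I, (W j).toReal * (-N j) := by
    rw [Finset.mul_sum, ← Finset.sum_neg_distrib, ← Finset.sum_add_distrib]
    exact Finset.sum_congr rfl fun j _ => by ring
  have hK₁ : A' ^ 2 / (4 * ε) ≤ ((3 * (K.Cr : ℝ) ^ 2 + 1) * A' ^ 2 / 4 + 1) / ν := by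
    rw [hε, div_le_div_iff₀ (by positivity) hν]
    calc A' ^ 2 * ν = ((3 * (K.Cr : ℝ) ^ 2 + 1) * A' ^ 2 / 4) * (4 * (ν / (3 * (K.Cr : ℝ) ^ 2 + 1))) := by
          field_simp
      _ ≤ ((3 * (K.Cr : ℝ) ^ 2 + 1) * A' ^ 2 / 4 + 1) * (4 * (ν / (3 * (K.Cr : ℝ) ^ 2 + 1))) := by
          gcongr; linarith
  calc ∑ j ∈ I, (W j).toReal * (-ν * S j - N j)
      = -(ν * ∑ j ∈ I, (W j).toReal * S j) + ∑ j ∈ I, (W j).toReal * (-N j) := hsplit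
    _ ≤ -(ε * DL.toReal) + A' * y.toReal * D.toReal ^ (1 / 2 : ℝ) := add_le_add (neg_le_neg hvisc) hnl
    _ ≤ -(ε * DL.toReal) + (ε * D.toReal + A' ^ 2 / (4 * ε) * y.toReal ^ 2) := by linarith [hyoung]
    _ ≤ ε * R.toReal + A' ^ 2 / (4 * ε) * y.toReal ^ 2 := by nlinarith [htail, hε0.le]
    _ ≤ ε * R.toReal + ((3 * (K.Cr : ℝ) ^ 2 + 1) * A' ^ 2 / 4 + 1) / ν * y.toReal ^ 2 := by
        gcongr

end Summit.NavierStokesRegularity.FluidComputer.RiccatiSlice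

end
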